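import Literature.Analysis.FluidPDE.PassiveVectorTensorGalerkin
import Literature.Analysis.FunctionSpaces.TorusLinearisedFormTruncation
import Literature.Analysis.FunctionSpaces.TorusSpaceTimeFields
import HarnessLib

/-!
# The Fourier–Galerkin scheme for the passive solenoidal vector with a constant viscosity tensor and a
  SMOOTH (not band-limited) carrier, I: the truncated system, energy inequality, global existence

Analysis/FluidPDE proof-support file (definitions with bodies + theorems; no named facts). Variant of
`PassiveVectorTensorGalerkin` (tenure ruling D26-17 of cell `ad-ideate`, K1L_D) in which the carrier `b(t, ·)` is
an ARBITRARY smooth divergence-free field, jointly continuous in `(t, x)`, with `‖b‖ ≤ M` and `|∂_c b_a| ≤ G`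
(`Torus.SmoothCarrier b M G`) — the coarse drift `b_{≤m}` of the Lagrangian cascade is a Lagrangian push-forward and
NOT a trigonometric polynomial, so the carrier is NOT truncated: the `k`-th Galerkin equation uses the exact Fourier
coefficient `𝓕[(b·∇)u_N](k)` of the transport of the approximation `u_N = realTrigPoly S c` (only finitely many
carrier modes enter each equation; Robinson–Rodrigo–Sadowski 2016, Thm. 4.4 Step 1 (4.5) with `P_N[(u·∇)u]`
replaced by `P_N[(b·∇)u_N]`).  The tensor term carries a tensor PARAMETER `𝔸` through the adjoint symbol
`T_𝔸(k)` (`Torus.symbT`), exactly as in `PassiveVectorTensorGalerkin`; consumers who want the forward problem of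
the class `IsWeakTensorPassiveVectorOn 0 T 𝔹` run the scheme with `𝔸 = majorTranspose 𝔹` (sequel files).

* `Torus.pvsField 𝔸 S b c k = −4π² Π_k T_𝔸(k) (c k) − Π_k 𝓕[(b·∇) realTrigPoly S c](k)`, its restriction `pvsRHS`;
* transversality, reality, invariance of the Galerkin phase space `galerkinSubspace S`;
* the **energy identity** `∑_k Re⟪c k, V k⟫ = −4π² ∑_k Re⟪c k, T_𝔸(k) c k⟫ ≤ −lo‖∇u‖²` (`NearIso 𝔸 lo hi`);
* the linear Lipschitz bound in the state, continuity in time, and **global existence** of Galerkin solutions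
  in `galerkinSubspace S` with non-increasing coefficient energy (`exists_pvsGalerkin_solution`), for `0 ≤ lo`;
* the `N`-uniform per-mode bound `‖𝓕[(b·∇)u](k)‖ ≤ 2π M (Σ_j |k_j|) √d (∫‖u‖²)^{1/2}` (antisymmetry), the input
  of the equi-Lipschitz estimate of the sequel.

## References

* J. C. Robinson, J. L. Rodrigo, W. Sadowski, *The three-dimensional Navier–Stokes equations* (CUP 2016), §4.1,
  Thm. 4.4 Steps 1–2, (4.2)–(4.8), Lemma 3.2. [`RobinsonRodrigoSadowski2016`]
* P. Constantin, C. Foias, *Navier–Stokes Equations* (Chicago 1988), Ch. 8, (8.3)–(8.9). [`ConstantinFoias1988`]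
* U. Frisch, *Turbulence* (CUP 1995), §9.6.3 eq. (9.57). [`Frisch1995Turbulence`]
-/

open MeasureTheory Set Filter Topology UnitAddTorus Metric Function
open scoped ENNReal NNReal InnerProductSpace

noncomputable section

namespace Literature.Analysis.FluidPDE

namespace Torus

open FunctionSpaces.Torus FunctionSpaces

variable {d : Type*} [Fintype d] [DecidableEq d]

/-! ## §0 Smooth carriers -/

section Carrier

/-- **A smooth bounded carrier with bounded gradient**: `b : ℝ → T^d → ℝ^d` jointly continuous, every slice
smooth and (classically) divergence free, `‖b t x‖ ≤ M` and `|∂_c (b t)_a (x)| ≤ G` for all `t, x`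
(the coarse drifts of a Lagrangian cascade; Robinson–Rodrigo–Sadowski 2016, Thm. 4.4: a smooth given velocity).
[cite: RobinsonRodrigoSadowski2016, Thm. 4.4 Step 1] -/
structure SmoothCarrier (b : ℝ → UnitAddTorus d → EuclideanSpace ℝ d) (M G : ℝ) : Prop where
  continuous : Continuous (uncurry b)
  smooth : ∀ t, IsSmooth (b t)
  divFree : ∀ t, IsDivFree (b t)
  norm_le : ∀ t x, ‖b t x‖ ≤ M
  grad_nonneg : 0 ≤ G
  grad_le : ∀ t x c a, |FunctionSpaces.Torus.partialDeriv c (b t) x a| ≤ G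

variable {b : ℝ → UnitAddTorus d → EuclideanSpace ℝ d} {M G : ℝ}

/-- The sup bound of a smooth carrier is nonnegative. [cite: RobinsonRodrigoSadowski2016, Thm. 4.4 Step 1] -/
theorem SmoothCarrier.nonneg (hb : SmoothCarrier b M G) : 0 ≤ M :=
  (norm_nonneg _).trans (hb.norm_le 0 0)

/-- Time shifts of a smooth carrier are smooth carriers with the same constants. [cite: RobinsonRodrigoSadowski2016, Thm. 4.4 Step 1] -/
theorem SmoothCarrier.comp_add (hb : SmoothCarrier b M G) (s : ℝ) : SmoothCarrier (fun τ => b (s + τ)) M G where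
  continuous := by
    have h : (uncurry fun τ => b (s + τ)) = uncurry b ∘ fun p : ℝ × UnitAddTorus d => (s + p.1, p.2) := by
      funext p; rfl
    rw [h]
    exact hb.continuous.comp ((continuous_const.add continuous_fst).prodMk continuous_snd)
  smooth := fun t => hb.smooth _
  divFree := fun t => hb.divFree _
  norm_le := fun t x => hb.norm_le _ x
  grad_nonneg := hb.grad_nonneg
  grad_le := fun t x c a => hb.grad_le _ x c a

/-- The space–time lift of a smooth carrier is continuous. [cite: RobinsonRodrigoSadowski2016, Thm. 4.4 Step 1] -/
theorem SmoothCarrier.continuous_stLift (hb : SmoothCarrier b M G) : Continuous (stLift b) :=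
  hb.continuous.comp (continuous_fst.prodMk (continuous_proj.comp continuous_snd))

/-- Each slice of a smooth carrier is weakly divergence free. [cite: RobinsonRodrigoSadowski2016, Lemma 2.3] -/
theorem SmoothCarrier.isWeaklyDivFree (hb : SmoothCarrier b M G) (t : ℝ) : FunctionSpaces.Torus.IsWeaklyDivFree (b t) :=
  (hb.divFree t).isWeaklyDivFree_holds (hb.smooth t)

end Carrier

/-! ## §1 The Galerkin field with the exact transport coefficient -/

section Field

variable {S : Finset (d → ℤ)}

/-- The `k`-th Fourier coefficient of the transport `(b·∇)u` of the real trigonometric polynomial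
`u = realTrigPoly S c` by the field `b`. [cite: RobinsonRodrigoSadowski2016, Thm. 4.4 Step 1 (4.5)] -/
def pvsConvCoeff (S : Finset (d → ℤ)) (b : UnitAddTorus d → EuclideanSpace ℝ d)
    (c : (d → ℤ) → EuclideanSpace ℂ d) (k : d → ℤ) : EuclideanSpace ℂ d :=
  mFourierCoeff (EuclideanSpace.complexify ∘ FunctionSpaces.Torus.convect b (realTrigPoly S c)) k

omit [DecidableEq d] in
/-- Unfolding of `pvsConvCoeff`. [cite: RobinsonRodrigoSadowski2016, Thm. 4.4 Step 1 (4.5)] -/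
theorem pvsConvCoeff_def (S : Finset (d → ℤ)) (b : UnitAddTorus d → EuclideanSpace ℝ d)
    (c : (d → ℤ) → EuclideanSpace ℂ d) (k : d → ℤ) :
    pvsConvCoeff S b c k =
      mFourierCoeff (EuclideanSpace.complexify ∘ FunctionSpaces.Torus.convect b (realTrigPoly S c)) k := rfl

/-- The transport of a real trigonometric polynomial by a continuous field is smooth enough: it is continuous
and square integrable. [cite: RobinsonRodrigoSadowski2016, Thm. 4.4 Step 1 (4.5)] -/
theorem continuous_convect_realTrigPoly {b : UnitAddTorus d → EuclideanSpace ℝ d} (hb : Continuous b)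
    (c : (d → ℤ) → EuclideanSpace ℂ d) :
    Continuous (FunctionSpaces.Torus.convect b (realTrigPoly S c)) := by
  have e : FunctionSpaces.Torus.convect b (realTrigPoly S c) =
      fun x => ∑ i, (b x) i • FunctionSpaces.Torus.partialDeriv i (realTrigPoly S c) x := by
    funext x
    rw [FunctionSpaces.Torus.convect, fderiv_apply_eq_sum_partialDeriv ((isSmooth_realTrigPoly S c).isContDiff (by simp))]
  rw [e]
  refine continuous_finsetSum _ fun i _ => ?_
  exact ((EuclideanSpace.proj (𝕜 := ℝ) i).continuous.comp hb).smul
    ((isSmooth_realTrigPoly S c).partialDeriv i).continuous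

/-- The transport of a real trigonometric polynomial by a continuous field is in `L²`. [cite: RobinsonRodrigoSadowski2016, Thm. 4.4 Step 1 (4.5)] -/
theorem memLp_convect_realTrigPoly {b : UnitAddTorus d → EuclideanSpace ℝ d} (hb : Continuous b)
    (c : (d → ℤ) → EuclideanSpace ℂ d) (p : ℝ≥0∞) :
    MemLp (FunctionSpaces.Torus.convect b (realTrigPoly S c)) p volume :=
  (continuous_convect_realTrigPoly hb c).memLp_of_hasCompactSupport (HasCompactSupport.of_compactSpace _)

/-- The transport coefficients of a real state are conjugate symmetric (Fourier coefficients of a real field).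
[cite: ConstantinFoias1988, Ch. 8 (8.3)–(8.5)] -/
theorem isConjSymm_pvsConvCoeff {b : UnitAddTorus d → EuclideanSpace ℝ d} (hb : Continuous b)
    (c : (d → ℤ) → EuclideanSpace ℂ d) : IsConjSymm (pvsConvCoeff S b c) :=
  isConjSymm_mFourierCoeff ((memLp_convect_realTrigPoly hb c 2).integrable one_le_two)

/-- **The Galerkin vector field with exact transport coefficient**:
`pvsField 𝔸 S b c k = −4π² Π_k T_𝔸(k)(c k) − Π_k 𝓕[(b·∇) realTrigPoly S c](k)`.
[cite: RobinsonRodrigoSadowski2016, Thm. 4.4 Step 1 (4.5)] -/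
def pvsField (𝔸 : Visc4 d) (S : Finset (d → ℤ)) (b : UnitAddTorus d → EuclideanSpace ℝ d)
    (c : (d → ℤ) → EuclideanSpace ℂ d) (k : d → ℤ) : EuclideanSpace ℂ d :=
  -(((4 * Real.pi ^ 2 : ℝ) : ℂ) • leraySym k (symbT 𝔸 k (c k))) - leraySym k (pvsConvCoeff S b c k)

omit [DecidableEq d] in
/-- Unfolding of `pvsField`. [cite: RobinsonRodrigoSadowski2016, Thm. 4.4 Step 1 (4.5)] -/
theorem pvsField_def (𝔸 : Visc4 d) (S : Finset (d → ℤ)) (b : UnitAddTorus d → EuclideanSpace ℝ d)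
    (c : (d → ℤ) → EuclideanSpace ℂ d) (k : d → ℤ) :
    pvsField 𝔸 S b c k =
      -(((4 * Real.pi ^ 2 : ℝ) : ℂ) • leraySym k (symbT 𝔸 k (c k))) - leraySym k (pvsConvCoeff S b c k) := rfl

omit [DecidableEq d] in
/-- **Transversality** of the field (both terms are Leray-projected). [cite: ConstantinFoias1988, Ch. 8 (8.3)–(8.5)] -/
theorem sum_mul_pvsField_apply (𝔸 : Visc4 d) (S : Finset (d → ℤ)) (b : UnitAddTorus d → EuclideanSpace ℝ d)
    (c : (d → ℤ) → EuclideanSpace ℂ d) (k : d → ℤ) :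
    ∑ i, (k i : ℂ) * pvsField 𝔸 S b c k i = 0 := by
  have h1 : ∑ i, (k i : ℂ) * ((((4 * Real.pi ^ 2 : ℝ) : ℂ) • leraySym k (symbT 𝔸 k (c k))) i) =
      (((4 * Real.pi ^ 2 : ℝ) : ℂ)) * ∑ i, (k i : ℂ) * leraySym k (symbT 𝔸 k (c k)) i := by
    rw [Finset.mul_sum]
    refine Finset.sum_congr rfl fun i _ => ?_
    rw [PiLp.smul_apply, smul_eq_mul]
    ring
  simp only [pvsField, PiLp.sub_apply, PiLp.neg_apply, mul_sub, mul_neg,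
    Finset.sum_sub_distrib, Finset.sum_neg_distrib, sum_mul_leraySym_apply, h1, mul_zero,
    neg_zero, sub_zero]

omit [DecidableEq d] in
/-- The field is transversal on `S`. [cite: ConstantinFoias1988, Ch. 8 (8.3)–(8.5)] -/
theorem isTransversal_pvsField (𝔸 : Visc4 d) (b : UnitAddTorus d → EuclideanSpace ℝ d)
    (c : (d → ℤ) → EuclideanSpace ℂ d) : IsTransversal S (pvsField 𝔸 S b c) :=
  fun k _ => sum_mul_pvsField_apply 𝔸 S b c k

/-- **Conjugate symmetry** of the field for a conjugate-symmetric state and a continuous (real) carrier.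
[cite: ConstantinFoias1988, Ch. 8 (8.3)–(8.5)] -/
theorem _root_.Literature.Analysis.FunctionSpaces.Torus.IsConjSymm.pvsField (𝔸 : Visc4 d)
    {b : UnitAddTorus d → EuclideanSpace ℝ d} (hb : Continuous b)
    {c : (d → ℤ) → EuclideanSpace ℂ d} (hc : IsConjSymm c) :
    IsConjSymm (pvsField 𝔸 S b c) := by
  intro k
  have ht := (isConjSymm_pvsConvCoeff (S := S) hb c) k
  rw [pvsField_def, pvsField_def, FunctionSpaces.EuclideanSpace.conjVec_sub,
    FunctionSpaces.EuclideanSpace.conjVec_neg, FunctionSpaces.EuclideanSpace.conjVec_smul, Complex.conj_ofReal,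
    hc k, leraySym_neg_freq, leraySym_neg_freq, ht, conjVec_leraySym, conjVec_leraySym, conjVec_symbT]

/-! ### The energy identity and inequality -/

/-- **The energy identity**: for real transversal `c` on a symmetric `S` and a smooth divergence-free carrier,
`∑_{k∈S} Re⟪c k, V k⟫ = −4π² ∑_{k∈S} Re⟪c k, T_𝔸(k) (c k)⟫` (the transport term drops out:
`∑ Re⟪c k, 𝓕[(b·∇)u](k)⟫ = ∫⟪u,(b·∇)u⟫ = 0`). [cite: RobinsonRodrigoSadowski2016, Thm. 4.4 Step 2 (4.6)–(4.7)] -/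
theorem sum_re_inner_pvsField_self_eq (𝔸 : Visc4 d) (hS : ∀ k ∈ S, -k ∈ S)
    {b : UnitAddTorus d → EuclideanSpace ℝ d} (hb : IsSmooth b) (hbdiv : IsDivFree b)
    {c : (d → ℤ) → EuclideanSpace ℂ d} (hc : IsConjSymm c) (hcT : IsTransversal S c) :
    ∑ k ∈ S, (inner ℂ (c k) (pvsField 𝔸 S b c k)).re =
      -(4 * Real.pi ^ 2 * ∑ k ∈ S, (inner ℂ (c k) (symbT 𝔸 k (c k))).re) := by
  have hu : IsSmooth (realTrigPoly S c) := isSmooth_realTrigPoly S c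
  have hsplit : ∀ k ∈ S, (inner ℂ (c k) (pvsField 𝔸 S b c k)).re =
      -(4 * Real.pi ^ 2 * (inner ℂ (c k) (symbT 𝔸 k (c k))).re) -
        (inner ℂ (c k) (pvsConvCoeff S b c k)).re := by
    intro k hk
    rw [pvsField, inner_sub_right, Complex.sub_re, inner_leraySym_right_of_transversal _ _
      (hcT k hk), inner_neg_right, Complex.neg_re, inner_smul_right, inner_leraySym_right_of_transversal _ _
      (hcT k hk), Complex.re_ofReal_mul]
  rw [Finset.sum_congr rfl hsplit, Finset.sum_sub_distrib, Finset.sum_neg_distrib, ← Finset.mul_sum]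
  have hnl : ∑ k ∈ S, (inner ℂ (c k) (pvsConvCoeff S b c k)).re = 0 := by
    have h1 := integral_inner_realTrigPoly_left hS hc (memLp_convect_realTrigPoly (S := S) hb.continuous c 2)
    simp only [pvsConvCoeff_def]
    rw [← h1]
    exact integral_inner_convect_right_self_eq_zero hb hbdiv hu
  rw [hnl, sub_zero]

/-- **The energy inequality**: for `NearIso 𝔸 lo hi`, `∑_{k∈S} Re⟪c k, V k⟫ ≤ −lo ‖∇u‖²`, `u = realTrigPoly S c`.
[cite: RobinsonRodrigoSadowski2016, Thm. 4.4 Step 2 (4.6)–(4.8)] -/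
theorem sum_re_inner_pvsField_self_le {𝔸 : Visc4 d} {lo hi : ℝ} (h𝔸 : NearIso 𝔸 lo hi)
    (hS : ∀ k ∈ S, -k ∈ S) {b : UnitAddTorus d → EuclideanSpace ℝ d} (hb : IsSmooth b) (hbdiv : IsDivFree b)
    {c : (d → ℤ) → EuclideanSpace ℂ d} (hc : IsConjSymm c) (hcT : IsTransversal S c) :
    ∑ k ∈ S, (inner ℂ (c k) (pvsField 𝔸 S b c k)).re ≤ -(lo * (eGradNormSq (realTrigPoly S c)).toReal) := by
  rw [sum_re_inner_pvsField_self_eq 𝔸 hS hb hbdiv hc hcT, toReal_eGradNormSq_realTrigPoly hS hc]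
  have h : lo * (4 * Real.pi ^ 2 * ∑ k ∈ S, freqNormSq k * ‖c k‖ ^ 2) ≤
      4 * Real.pi ^ 2 * ∑ k ∈ S, (inner ℂ (c k) (symbT 𝔸 k (c k))).re := by
    rw [mul_left_comm, Finset.mul_sum]
    exact mul_le_mul_of_nonneg_left
      (Finset.sum_le_sum fun k hk => lo_mul_le_re_inner_symbT h𝔸 (hcT k hk)) (by positivity)
  linarith

/-! ### Size of the transport coefficient -/

omit [DecidableEq d] in
/-- `‖𝓕 g (k)‖ ≤ ∫‖g‖` for an integrable `g`. [folklore] -/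
private theorem norm_mFourierCoeff_le_integral_norm₀ {F : Type*} [NormedAddCommGroup F] [NormedSpace ℂ F]
    [CompleteSpace F] {g : UnitAddTorus d → F} (hg : Integrable g volume) (k : d → ℤ) :
    ‖mFourierCoeff g k‖ ≤ ∫ x, ‖g x‖ := by
  rw [mFourierCoeff_eq_integral_volume]
  refine (norm_integral_le_integral_norm _).trans (integral_mono_of_nonneg (Eventually.of_forall fun x => norm_nonneg _)
    hg.norm (Eventually.of_forall fun x => ?_))
  show ‖(mFourier (-k) x : ℂ) • g x‖ ≤ ‖g x‖
  rw [norm_smul]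
  calc ‖(mFourier (-k) x : ℂ)‖ * ‖g x‖ ≤ 1 * ‖g x‖ :=
        mul_le_mul_of_nonneg_right (((mFourier (-k)).norm_coe_le_norm x).trans_eq mFourier_norm) (norm_nonneg _)
    _ = ‖g x‖ := one_mul _

omit [DecidableEq d] in
/-- An integral over the torus (a probability space) of an integrable function bounded by a constant is bounded
by that constant. [folklore] -/
private theorem integral_le_of_le_const {f : UnitAddTorus d → ℝ} (hfi : Integrable f volume) {C : ℝ}
    (hf : ∀ x, f x ≤ C) : ∫ x, f x ≤ C := by
  calc ∫ x, f x ≤ ∫ _x, C := integral_mono hfi (integrable_const C) hf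
    _ = C := by simp [Measure.real]

/-- **Pointwise size of the transport of a trigonometric polynomial**: for `‖b x‖ ≤ M`,
`‖(b·∇) realTrigPoly S c (x)‖ ≤ M · 2π (∑_{l∈S} ∑_j |l_j|) · sup_l ‖c l‖` whenever `‖c l‖ ≤ R` on `S`.
[cite: RobinsonRodrigoSadowski2016, Thm. 4.4 Step 1 (4.5)] -/
theorem norm_convect_realTrigPoly_le {b : UnitAddTorus d → EuclideanSpace ℝ d} {M : ℝ} (hM : 0 ≤ M)
    (hb : ∀ x, ‖b x‖ ≤ M) {c : (d → ℤ) → EuclideanSpace ℂ d} {R : ℝ} (hc : ∀ l ∈ S, ‖c l‖ ≤ R)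
    (x : UnitAddTorus d) :
    ‖FunctionSpaces.Torus.convect b (realTrigPoly S c) x‖ ≤
      M * (2 * Real.pi * (∑ l ∈ S, ∑ j, |(l j : ℝ)|) * R) := by
  have hu : IsContDiff 1 (realTrigPoly S c) := (isSmooth_realTrigPoly S c).isContDiff (by simp)
  refine (norm_convect_le b hu x).trans ?_
  refine mul_le_mul (hb x) ?_ (Finset.sum_nonneg fun i _ => norm_nonneg _) hM
  calc ∑ i, ‖FunctionSpaces.Torus.partialDeriv i (realTrigPoly S c) x‖
      ≤ ∑ i, ∑ l ∈ S, 2 * Real.pi * |(l i : ℝ)| * ‖c l‖ :=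
        Finset.sum_le_sum fun i _ => norm_partialDeriv_realTrigPoly_le S c i x
    _ ≤ ∑ i, ∑ l ∈ S, 2 * Real.pi * |(l i : ℝ)| * R := by
        refine Finset.sum_le_sum fun i _ => Finset.sum_le_sum fun l hl => ?_
        exact mul_le_mul_of_nonneg_left (hc l hl) (by positivity)
    _ = 2 * Real.pi * (∑ l ∈ S, ∑ j, |(l j : ℝ)|) * R := by
        rw [Finset.sum_comm, Finset.mul_sum, Finset.sum_mul]
        refine Finset.sum_congr rfl fun l _ => ?_
        rw [Finset.mul_sum, Finset.sum_mul]

/-- **Sup-norm bound of the transport coefficient**: `‖𝓕[(b·∇)u](k)‖ ≤ M · 2π (∑_{l∈S}∑_j|l_j|) · R` for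
`‖b‖ ≤ M` and `‖c l‖ ≤ R` on `S` (`|𝓕 g(k)| ≤ ∫|g| ≤ sup |g|`). [cite: RobinsonRodrigoSadowski2016, Thm. 4.4 Step 1 (4.5)] -/
theorem norm_pvsConvCoeff_le {b : UnitAddTorus d → EuclideanSpace ℝ d} (hbc : Continuous b) {M : ℝ} (hM : 0 ≤ M)
    (hb : ∀ x, ‖b x‖ ≤ M) {c : (d → ℤ) → EuclideanSpace ℂ d} {R : ℝ} (hc : ∀ l ∈ S, ‖c l‖ ≤ R)
    (k : d → ℤ) :
    ‖pvsConvCoeff S b c k‖ ≤ M * (2 * Real.pi * (∑ l ∈ S, ∑ j, |(l j : ℝ)|) * R) := by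
  have hgi : Integrable (EuclideanSpace.complexify ∘ FunctionSpaces.Torus.convect b (realTrigPoly S c)) volume :=
    integrable_complexify_comp ((memLp_convect_realTrigPoly hbc c 2).integrable one_le_two)
  refine (norm_mFourierCoeff_le_integral_norm₀ hgi k).trans ?_
  refine integral_le_of_le_const hgi.norm fun x => ?_
  rw [Function.comp_apply, EuclideanSpace.norm_complexify]
  exact norm_convect_realTrigPoly_le hM hb hc x

/-- The transport coefficient is additive in the state. [cite: RobinsonRodrigoSadowski2016, Thm. 4.4 Step 1 (4.5)] -/
theorem pvsConvCoeff_sub {b : UnitAddTorus d → EuclideanSpace ℝ d} (hbc : Continuous b)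
    (c c' : (d → ℤ) → EuclideanSpace ℂ d) (k : d → ℤ) :
    pvsConvCoeff S b c k - pvsConvCoeff S b c' k = pvsConvCoeff S b (c - c') k := by
  have hu : IsContDiff 1 (realTrigPoly S c) := (isSmooth_realTrigPoly S c).isContDiff (by simp)
  have hu' : IsContDiff 1 (realTrigPoly S c') := (isSmooth_realTrigPoly S c').isContDiff (by simp)
  rw [pvsConvCoeff_def, pvsConvCoeff_def, pvsConvCoeff_def,
    ← mFourierCoeff_sub (integrable_complexify_comp ((memLp_convect_realTrigPoly hbc c 2).integrable one_le_two))
      (integrable_complexify_comp ((memLp_convect_realTrigPoly hbc c' 2).integrable one_le_two))]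
  congr 1
  funext x
  simp only [Pi.sub_apply, Function.comp_apply]
  rw [realTrigPoly_sub, convect_sub b hu hu' x, map_sub]

end Field

end Torus

/-! ## §2 The phase space and the field on `S → ℂ^d` -/

section PVS

open FunctionSpaces.Torus FunctionSpaces Torus

variable {d : Type*} [Fintype d]

section RHS

variable [DecidableEq d] {S : Finset (d → ℤ)}

variable (S) in
/-- The Galerkin field on coefficient vectors: `V(b, c)_k = pvsField 𝔸 S b c̄ k`, `k ∈ S`, `c̄` the extension by
zero. [cite: RobinsonRodrigoSadowski2016, Thm. 4.4 Step 1 (4.5)] -/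
def pvsRHS (𝔸 : Visc4 d) (b : UnitAddTorus d → EuclideanSpace ℝ d) (c : ↥S → EuclideanSpace ℂ d) :
    ↥S → EuclideanSpace ℂ d :=
  fun k => pvsField 𝔸 S b (coeffExt S c) k

omit [DecidableEq d] in
/-- Unfolding of `pvsRHS`. [cite: RobinsonRodrigoSadowski2016, Thm. 4.4 Step 1 (4.5)] -/
theorem pvsRHS_apply (𝔸 : Visc4 d) (b : UnitAddTorus d → EuclideanSpace ℝ d) (c : ↥S → EuclideanSpace ℂ d) (k : ↥S) :
    pvsRHS S 𝔸 b c k = pvsField 𝔸 S b (coeffExt S c) k := rfl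

/-- **Invariance of the Galerkin phase space**: for a continuous (real) carrier the field maps real transversal
coefficient vectors to real transversal ones. [cite: ConstantinFoias1988, Ch. 8 (8.3)–(8.5)] -/
theorem pvsRHS_mem (𝔸 : Visc4 d) (hS : ∀ k ∈ S, -k ∈ S) {b : UnitAddTorus d → EuclideanSpace ℝ d}
    (hb : Continuous b) {c : ↥S → EuclideanSpace ℂ d} (hc : c ∈ galerkinSubspace S) :
    pvsRHS S 𝔸 b c ∈ galerkinSubspace S := by
  refine ⟨?_, ?_⟩
  · exact isRealCoeff_restrict ((hc.1.isConjSymm_coeffExt hS).pvsField 𝔸 hb)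
  · exact isSolenoidalCoeff_restrict (isTransversal_pvsField 𝔸 b (coeffExt S c))

/-! ### Lipschitz and continuity bounds -/

variable (S) in
/-- The Lipschitz constant of the field on the frequency set `S` for a carrier bounded by `M`:
`symbConst S 𝔸 + M · 2π ∑_{l∈S} ∑_j |l_j|`. [cite: RobinsonRodrigoSadowski2016, Thm. 4.4 Step 1] -/
def pvsLip (𝔸 : Visc4 d) (M : ℝ) : ℝ := symbConst S 𝔸 + M * (2 * Real.pi * ∑ l ∈ S, ∑ j, |(l j : ℝ)|)

omit [DecidableEq d] in
/-- The Lipschitz constant is nonnegative for `M ≥ 0`. [cite: RobinsonRodrigoSadowski2016, Thm. 4.4 Step 1] -/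
theorem pvsLip_nonneg (𝔸 : Visc4 d) {M : ℝ} (hM : 0 ≤ M) : 0 ≤ pvsLip S 𝔸 M := by
  unfold pvsLip
  have := symbConst_nonneg (S := S) 𝔸
  positivity

/-- **Linear Lipschitz bound**: `‖V(b, c) − V(b, c')‖ ≤ pvsLip S 𝔸 M · ‖c − c'‖` for `‖b‖ ≤ M` (sup norms; the
field is linear in the state). [cite: RobinsonRodrigoSadowski2016, Thm. 4.4 Step 1] -/
theorem norm_pvsRHS_sub_le (𝔸 : Visc4 d) {b : UnitAddTorus d → EuclideanSpace ℝ d} (hbc : Continuous b) {M : ℝ}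
    (hM : 0 ≤ M) (hb : ∀ x, ‖b x‖ ≤ M) (c c' : ↥S → EuclideanSpace ℂ d) :
    ‖pvsRHS S 𝔸 b c - pvsRHS S 𝔸 b c'‖ ≤ pvsLip S 𝔸 M * ‖c - c'‖ := by
  have hK : 0 ≤ pvsLip S 𝔸 M := pvsLip_nonneg 𝔸 hM
  refine (pi_norm_le_iff_of_nonneg (by positivity)).2 fun k => ?_
  rw [Pi.sub_apply, pvsRHS_apply, pvsRHS_apply, pvsField_def, pvsField_def]
  have hdl : ∀ l ∈ S, ‖(coeffExt S c - coeffExt S c') l‖ ≤ ‖c - c'‖ := fun l _ => by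
    rw [← coeffExt_sub]; exact norm_coeffExt_le _ l
  -- the tensor term (verbatim from `PassiveVectorTensorGalerkin.norm_pvtGalerkinRHS_sub_le`)
  have h1 : ‖-(((4 * Real.pi ^ 2 : ℝ) : ℂ) • leraySym k (symbT 𝔸 k (coeffExt S c k))) -
      -(((4 * Real.pi ^ 2 : ℝ) : ℂ) • leraySym k (symbT 𝔸 k (coeffExt S c' k)))‖ ≤
      symbConst S 𝔸 * ‖c - c'‖ := by
    rw [neg_sub_neg, ← smul_sub, ← leraySym_sub, norm_smul, Complex.norm_real,
      Real.norm_of_nonneg (by positivity : (0 : ℝ) ≤ 4 * Real.pi ^ 2)]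
    have hsub : symbT 𝔸 k (coeffExt S c' k) - symbT 𝔸 k (coeffExt S c k) =
        symbT 𝔸 k (coeffExt S c' k - coeffExt S c k) := by
      rw [sub_eq_add_neg, ← neg_one_smul ℂ (symbT 𝔸 k (coeffExt S c k)), ← symbT_smul, ← symbT_add, neg_one_smul,
        ← sub_eq_add_neg]
    have hcc : ‖coeffExt S c' k - coeffExt S c k‖ ≤ ‖c - c'‖ := by
      rw [norm_sub_rev, ← Pi.sub_apply]; exact hdl k k.2
    have hTk : ‖symbTL 𝔸 k‖ ≤ ∑ k' ∈ S, ‖symbTL 𝔸 k'‖ :=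
      Finset.single_le_sum (f := fun k' => ‖symbTL 𝔸 k'‖) (fun _ _ => norm_nonneg _) k.2
    calc 4 * Real.pi ^ 2 * ‖leraySym k (symbT 𝔸 k (coeffExt S c' k) - symbT 𝔸 k (coeffExt S c k))‖
        ≤ 4 * Real.pi ^ 2 * (‖symbTL 𝔸 k‖ * ‖c - c'‖) := by
          refine mul_le_mul_of_nonneg_left ((norm_leraySym_le _ _).trans ?_) (by positivity)
          rw [hsub]
          exact (norm_symbT_le_opNorm 𝔸 k _).trans (mul_le_mul_of_nonneg_left hcc (norm_nonneg _))
      _ ≤ 4 * Real.pi ^ 2 * ((∑ k' ∈ S, ‖symbTL 𝔸 k'‖) * ‖c - c'‖) :=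
          mul_le_mul_of_nonneg_left (mul_le_mul_of_nonneg_right hTk (norm_nonneg _)) (by positivity)
      _ = symbConst S 𝔸 * ‖c - c'‖ := by unfold symbConst; ring
  -- the projected transport term (linear in the state)
  have h2 : ‖leraySym k (pvsConvCoeff S b (coeffExt S c) k) - leraySym k (pvsConvCoeff S b (coeffExt S c') k)‖ ≤
      M * (2 * Real.pi * ∑ l ∈ S, ∑ j, |(l j : ℝ)|) * ‖c - c'‖ := by
    refine (norm_leraySym_sub_le _ _ _).trans ?_
    rw [pvsConvCoeff_sub hbc, ← coeffExt_sub]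
    have hb' := norm_pvsConvCoeff_le (S := S) hbc hM hb (R := ‖c - c'‖)
      (fun l hl => by
        have := hdl l hl
        rwa [← coeffExt_sub] at this) (k : d → ℤ)
    calc _ ≤ M * (2 * Real.pi * (∑ l ∈ S, ∑ j, |(l j : ℝ)|) * ‖c - c'‖) := hb'
      _ = M * (2 * Real.pi * ∑ l ∈ S, ∑ j, |(l j : ℝ)|) * ‖c - c'‖ := by ring
  have heq : -(((4 * Real.pi ^ 2 : ℝ) : ℂ) • leraySym k (symbT 𝔸 k (coeffExt S c k))) -
        leraySym k (pvsConvCoeff S b (coeffExt S c) k) -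
        (-(((4 * Real.pi ^ 2 : ℝ) : ℂ) • leraySym k (symbT 𝔸 k (coeffExt S c' k))) -
          leraySym k (pvsConvCoeff S b (coeffExt S c') k)) =
      (-(((4 * Real.pi ^ 2 : ℝ) : ℂ) • leraySym k (symbT 𝔸 k (coeffExt S c k))) -
          -(((4 * Real.pi ^ 2 : ℝ) : ℂ) • leraySym k (symbT 𝔸 k (coeffExt S c' k)))) -
        (leraySym k (pvsConvCoeff S b (coeffExt S c) k) - leraySym k (pvsConvCoeff S b (coeffExt S c') k)) := by
    abel
  rw [heq]
  have hK' := (norm_sub_le _ _).trans (add_le_add h1 h2)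
  calc _ ≤ symbConst S 𝔸 * ‖c - c'‖ + M * (2 * Real.pi * ∑ l ∈ S, ∑ j, |(l j : ℝ)|) * ‖c - c'‖ := hK'
    _ = pvsLip S 𝔸 M * ‖c - c'‖ := by unfold pvsLip; ring

/-- The field vanishes at the zero state. [cite: RobinsonRodrigoSadowski2016, Thm. 4.4 Step 1 (4.5)] -/
theorem pvsRHS_zero (𝔸 : Visc4 d) {b : UnitAddTorus d → EuclideanSpace ℝ d} (hbc : Continuous b) :
    pvsRHS S 𝔸 b 0 = 0 := by
  funext k
  rw [pvsRHS_apply, coeffExt_zero, pvsField_def]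
  have h0 : pvsConvCoeff S b (0 : (d → ℤ) → EuclideanSpace ℂ d) k = 0 := by
    have h := pvsConvCoeff_sub (S := S) hbc (0 : (d → ℤ) → EuclideanSpace ℂ d) 0 (k : d → ℤ)
    rw [sub_self] at h
    rw [sub_self] at h
    exact h.symm
  simp [h0, leraySym_zero]

/-- Linear growth bound `‖V(b, c)‖ ≤ pvsLip S 𝔸 M ‖c‖`. [cite: RobinsonRodrigoSadowski2016, Thm. 4.4 Step 1 (4.5)] -/
theorem norm_pvsRHS_le (𝔸 : Visc4 d) {b : UnitAddTorus d → EuclideanSpace ℝ d} (hbc : Continuous b) {M : ℝ}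
    (hM : 0 ≤ M) (hb : ∀ x, ‖b x‖ ≤ M) (c : ↥S → EuclideanSpace ℂ d) :
    ‖pvsRHS S 𝔸 b c‖ ≤ pvsLip S 𝔸 M * ‖c‖ := by
  have h := norm_pvsRHS_sub_le 𝔸 hbc hM hb c 0
  rwa [pvsRHS_zero 𝔸 hbc, sub_zero, sub_zero] at h

/-- **Continuity of the field in time for a fixed state**, along a jointly continuous carrier
(`t ↦ 𝓕[(b(t)·∇)u](k)` is continuous: a Fourier coefficient of a jointly continuous space–time field).
[cite: RobinsonRodrigoSadowski2016, Thm. 4.4 Step 1 (4.5)] -/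
theorem continuous_pvsRHS_left (𝔸 : Visc4 d) {b : ℝ → UnitAddTorus d → EuclideanSpace ℝ d}
    (hb : Continuous (uncurry b)) (c : ↥S → EuclideanSpace ℂ d) : Continuous fun t => pvsRHS S 𝔸 (b t) c := by
  refine continuous_pi fun k => ?_
  simp only [pvsRHS_apply, pvsField_def]
  refine continuous_const.sub ((continuous_leraySym (k : d → ℤ)).comp ?_)
  -- continuity of the transport coefficient in `t`
  have hu : IsContDiff 1 (realTrigPoly S (coeffExt S c)) := (isSmooth_realTrigPoly S _).isContDiff (by simp)
  have hst : ContinuousOn (stLift fun t => FunctionSpaces.Torus.convect (b t) (realTrigPoly S (coeffExt S c)))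
      (univ ×ˢ univ) := by
    have e : (stLift fun t => FunctionSpaces.Torus.convect (b t) (realTrigPoly S (coeffExt S c))) =
        fun q : ℝ × EuclideanSpace ℝ d => ∑ i, (uncurry b (q.1, proj q.2)) i •
          FunctionSpaces.Torus.partialDeriv i (realTrigPoly S (coeffExt S c)) (proj q.2) := by
      funext q
      obtain ⟨t, y⟩ := q
      rw [stLift_apply, FunctionSpaces.Torus.convect, fderiv_apply_eq_sum_partialDeriv hu]
      rfl
    rw [e]
    refine (continuous_finsetSum _ fun i _ => ?_).continuousOn
    exact ((EuclideanSpace.proj (𝕜 := ℝ) i).continuous.comp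
      (hb.comp (continuous_fst.prodMk (continuous_proj.comp continuous_snd)))).smul
      (((isSmooth_realTrigPoly S _).partialDeriv i).continuous.comp (continuous_proj.comp continuous_snd))
  have h := continuousOn_mFourierCoeff_of_continuousOn_stLift hst (k : d → ℤ)
  exact continuousOn_univ.1 h

/-- **Continuity of the field along continuous carrier and state curves** (Lipschitz in the state, uniformly
in time, and continuous in time for each state). [cite: RobinsonRodrigoSadowski2016, Thm. 4.4 Step 1 (4.5)] -/
theorem continuousOn_pvsRHS_comp (𝔸 : Visc4 d) {b : ℝ → UnitAddTorus d → EuclideanSpace ℝ d}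
    (hb : Continuous (uncurry b)) {M : ℝ} (hM : 0 ≤ M) (hbM : ∀ t x, ‖b t x‖ ≤ M)
    {s : Set ℝ} {α : ℝ → ↥S → EuclideanSpace ℂ d} (hα : ContinuousOn α s) :
    ContinuousOn (fun t => pvsRHS S 𝔸 (b t) (α t)) s := by
  intro t₀ ht₀
  have hbt : ∀ t, Continuous (b t) := fun t => hb.comp (continuous_const.prodMk continuous_id)
  have h1 : Tendsto (fun t => pvsRHS S 𝔸 (b t) (α t) - pvsRHS S 𝔸 (b t) (α t₀)) (𝓝[s] t₀) (𝓝 0) := by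
    have hb0 : ∀ t, ‖pvsRHS S 𝔸 (b t) (α t) - pvsRHS S 𝔸 (b t) (α t₀)‖ ≤ pvsLip S 𝔸 M * ‖α t - α t₀‖ := fun t =>
      norm_pvsRHS_sub_le 𝔸 (hbt t) hM (hbM t) _ _
    have hα0 : Tendsto (fun t => pvsLip S 𝔸 M * ‖α t - α t₀‖) (𝓝[s] t₀) (𝓝 0) := by
      have hc : ContinuousWithinAt (fun t => ‖α t - α t₀‖) s t₀ :=
        ((hα t₀ ht₀).sub (continuousWithinAt_const (b := α t₀))).norm
      have h' : Tendsto (fun t => ‖α t - α t₀‖) (𝓝[s] t₀) (𝓝 0) := by simpa using hc.tendsto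
      simpa using h'.const_mul (pvsLip S 𝔸 M)
    exact squeeze_zero_norm hb0 hα0
  have h2 : Tendsto (fun t => pvsRHS S 𝔸 (b t) (α t₀)) (𝓝[s] t₀) (𝓝 (pvsRHS S 𝔸 (b t₀) (α t₀))) :=
    ((continuous_pvsRHS_left 𝔸 hb (α t₀)).tendsto t₀).mono_left nhdsWithin_le_nhds
  have := h1.add h2
  rw [zero_add] at this
  exact this.congr fun t => by abel

end RHS

/-! ## §3 The energy along solutions and global existence -/

section Energy

variable [DecidableEq d] {S : Finset (d → ℤ)}

omit [DecidableEq d] in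
/-- **The energy identity in differential form along a Galerkin solution**: if `α' = V(b, α)` within `s` at
`t`, then `d/dt ∑_k ‖α k‖² = 2 ∑_k Re⟪α k, V k⟫`. [cite: RobinsonRodrigoSadowski2016, Thm. 4.4 Step 2 (4.6)] -/
theorem hasDerivWithinAt_pvsEnergy (𝔸 : Visc4 d) {α : ℝ → ↥S → EuclideanSpace ℂ d}
    {b : UnitAddTorus d → EuclideanSpace ℝ d} {s : Set ℝ} {t : ℝ}
    (h : HasDerivWithinAt α (pvsRHS S 𝔸 b (α t)) s t) :
    HasDerivWithinAt (fun τ => ∑ k, ‖α τ k‖ ^ 2)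
      (2 * ∑ k ∈ S, (inner ℂ (coeffExt S (α t) k) (pvsField 𝔸 S b (coeffExt S (α t)) k)).re) s t := by
  have h1 := hasDerivWithinAt_sum_norm_sq h
  have h2 : ∑ k, 2 * (inner ℂ (α t k) (pvsRHS S 𝔸 b (α t) k)).re =
      2 * ∑ k ∈ S, (inner ℂ (coeffExt S (α t) k) (pvsField 𝔸 S b (coeffExt S (α t)) k)).re := by
    rw [Finset.mul_sum, sum_coeffExt (fun k v => 2 * (inner ℂ v (pvsField 𝔸 S b (coeffExt S (α t)) k)).re)]
    rfl
  rw [h2] at h1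
  exact h1

/-- **The energy inequality in differential form**: for `NearIso 𝔸 lo hi`, a real transversal state and a smooth
divergence-free carrier, `2 ∑_k Re⟪α k, V k⟫ ≤ −2 lo ‖∇u‖²`. [cite: RobinsonRodrigoSadowski2016, Thm. 4.4 Step 2 (4.6)–(4.7)] -/
theorem pvsEnergy_deriv_le {𝔸 : Visc4 d} {lo hi : ℝ} (h𝔸 : NearIso 𝔸 lo hi) (hS : ∀ k ∈ S, -k ∈ S)
    {c : ↥S → EuclideanSpace ℂ d} (hc : c ∈ galerkinSubspace S)
    {b : UnitAddTorus d → EuclideanSpace ℝ d} (hb : IsSmooth b) (hbdiv : IsDivFree b) :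
    2 * ∑ k ∈ S, (inner ℂ (coeffExt S c k) (pvsField 𝔸 S b (coeffExt S c) k)).re ≤
      2 * -(lo * (eGradNormSq (realTrigPoly S (coeffExt S c))).toReal) :=
  mul_le_mul_of_nonneg_left (sum_re_inner_pvsField_self_le h𝔸 hS hb hbdiv (hc.1.isConjSymm_coeffExt hS)
    hc.2.isTransversal_coeffExt) (by norm_num)

/-- **The energy is non-increasing along Galerkin solutions** (`lo ≥ 0`): `∑_k ‖α t k‖² ≤ ∑_k ‖α t₁ k‖²` for
`0 ≤ t₁ ≤ t ≤ s'`. [cite: RobinsonRodrigoSadowski2016, Thm. 4.4 Step 2 (4.8)] -/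
theorem pvsEnergy_antitone_of_solution {𝔸 : Visc4 d} {lo hi : ℝ} (h𝔸 : NearIso 𝔸 lo hi) (hlo : 0 ≤ lo)
    (hS : ∀ k ∈ S, -k ∈ S) {b : ℝ → UnitAddTorus d → EuclideanSpace ℝ d}
    (hb : ∀ t, IsSmooth (b t)) (hbdiv : ∀ t, IsDivFree (b t))
    {s' : ℝ} {α : ℝ → ↥S → EuclideanSpace ℂ d}
    (hα : ∀ t ∈ Icc 0 s', HasDerivWithinAt α (pvsRHS S 𝔸 (b t) (α t)) (Icc 0 s') t)
    (hmem : ∀ t ∈ Icc 0 s', α t ∈ galerkinSubspace S) {t₁ t : ℝ} (h1 : 0 ≤ t₁) (h1t : t₁ ≤ t) (ht : t ≤ s') :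
    ∑ k, ‖α t k‖ ^ 2 ≤ ∑ k, ‖α t₁ k‖ ^ 2 := by
  set ψ : ℝ → ℝ := fun τ => ∑ k, ‖α τ k‖ ^ 2 with hψ
  set ψ' : ℝ → ℝ := fun τ => 2 * ∑ k ∈ S, (inner ℂ (coeffExt S (α τ) k)
    (pvsField 𝔸 S (b τ) (coeffExt S (α τ)) k)).re with hψ'
  have hsub : Icc t₁ t ⊆ Icc 0 s' := Icc_subset_Icc h1 ht
  have hderiv : ∀ τ ∈ Icc t₁ t, HasDerivWithinAt ψ (ψ' τ) (Icc t₁ t) τ := fun τ hτ =>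
    (hasDerivWithinAt_pvsEnergy 𝔸 (hα τ (hsub hτ))).mono hsub
  have hcont : ContinuousOn ψ (Icc t₁ t) := fun τ hτ => (hderiv τ hτ).continuousWithinAt
  have hbound : ∀ τ ∈ Ico t₁ t, ψ' τ ≤ 0 * ψ τ + 0 := by
    intro τ hτ
    have hE := pvsEnergy_deriv_le h𝔸 hS (hmem τ (hsub (Ico_subset_Icc_self hτ))) (hb τ) (hbdiv τ)
    have h0 : 0 ≤ lo * (eGradNormSq (realTrigPoly S (coeffExt S (α τ)))).toReal :=
      mul_nonneg hlo ENNReal.toReal_nonneg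
    have : ψ' τ = 2 * ∑ k ∈ S, (inner ℂ (coeffExt S (α τ) k)
      (pvsField 𝔸 S (b τ) (coeffExt S (α τ)) k)).re := rfl
    rw [this, zero_mul, add_zero]
    linarith
  have hgron := le_gronwallBound_of_liminf_deriv_right_le (f := ψ) (f' := ψ') (δ := ψ t₁)
    (K := 0) (ε := 0) (a := t₁) (b := t) hcont (fun τ hτ r hr => ?_) le_rfl hbound t ⟨h1t, le_rfl⟩
  · rw [gronwallBound_K0] at hgron
    simpa only [zero_mul, add_zero] using hgron
  · have hmem_nhds : Icc t₁ t ∈ 𝓝[Ici τ] τ :=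
      mem_nhdsWithin.2 ⟨Iio t, isOpen_Iio, hτ.2, fun z hz => ⟨hτ.1.trans hz.2, hz.1.le⟩⟩
    exact ((hderiv τ (Ico_subset_Icc_self hτ)).mono_of_mem_nhdsWithin hmem_nhds) |>.liminf_right_slope_le hr

/-- **Global existence for the Galerkin system with a smooth carrier.** Let `S` be a finite symmetric frequency
set, `NearIso 𝔸 lo hi` with `lo ≥ 0`, `b` a smooth carrier (`SmoothCarrier b M G`), and `c₀ ∈ galerkinSubspace S`.
Then `α' = V(b(t), α)` has a solution `α : ℝ → (S → ℂ^d)` with `α 0 = c₀`, valued in `galerkinSubspace S`,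
continuous on `[0, ∞)`, solving the equation on every `[0, T]`, with non-increasing coefficient energy.
[cite: RobinsonRodrigoSadowski2016, Thm. 4.4 Steps 1–2] -/
theorem exists_pvsGalerkin_solution {𝔸 : Visc4 d} {lo hi : ℝ} (h𝔸 : NearIso 𝔸 lo hi) (hlo : 0 ≤ lo)
    (hS : ∀ k ∈ S, -k ∈ S) {b : ℝ → UnitAddTorus d → EuclideanSpace ℝ d} {M G : ℝ} (hb : SmoothCarrier b M G)
    {c₀ : ↥S → EuclideanSpace ℂ d} (hc₀ : c₀ ∈ galerkinSubspace S) :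
    ∃ α : ℝ → ↥S → EuclideanSpace ℂ d, α 0 = c₀ ∧ (∀ t, α t ∈ galerkinSubspace S) ∧
      ContinuousOn α (Ici 0) ∧
      (∀ T, ∀ t ∈ Icc 0 T, HasDerivWithinAt α (pvsRHS S 𝔸 (b t) (α t)) (Icc 0 T) t) ∧
      ∀ t₁ t, 0 ≤ t₁ → t₁ ≤ t → ∑ k, ‖α t k‖ ^ 2 ≤ ∑ k, ‖α t₁ k‖ ^ 2 := by
  set Y := galerkinSubspace S with hY
  have hbt : ∀ t, Continuous (b t) := fun t => hb.continuous.comp (continuous_const.prodMk continuous_id)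
  set V : ℝ → Y → Y := fun t c => ⟨pvsRHS S 𝔸 (b t) c, pvsRHS_mem 𝔸 hS (hbt t) c.2⟩ with hV
  have hVcoe : ∀ t (c : Y), ((V t c : Y) : ↥S → EuclideanSpace ℂ d) = pvsRHS S 𝔸 (b t) c := fun t c => rfl
  -- Lipschitz, uniformly in time (linear field, bounded carrier)
  have hlip : ∀ T ρ : ℝ, ∃ K : ℝ≥0, ∀ t ∈ Icc 0 T, LipschitzOnWith K (V t) (closedBall 0 ρ) := by
    intro T ρ
    refine ⟨Real.toNNReal (pvsLip S 𝔸 M), fun t _ => ?_⟩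
    refine LipschitzOnWith.of_dist_le_mul fun c _ c' _ => ?_
    rw [Subtype.dist_eq, dist_eq_norm, dist_eq_norm, hVcoe, hVcoe]
    refine (norm_pvsRHS_sub_le 𝔸 (hbt t) hb.nonneg (hb.norm_le t) (c : ↥S → EuclideanSpace ℂ d)
      (c' : ↥S → EuclideanSpace ℂ d)).trans ?_
    exact mul_le_mul_of_nonneg_right (Real.le_coe_toNNReal _) (norm_nonneg _)
  -- continuity in time
  have hcont : ∀ c : Y, ContinuousOn (V · c) (Ici 0) := by
    intro c
    refine Continuous.continuousOn ?_
    exact (continuous_pvsRHS_left 𝔸 hb.continuous (c : ↥S → EuclideanSpace ℂ d)).subtype_mk _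
  -- a priori bound from the non-increase of the energy
  have hapriori : ∀ T : ℝ, 0 ≤ T → ∃ R : ℝ, ‖(⟨c₀, hc₀⟩ : Y)‖ ≤ R ∧
      ∀ s ∈ Icc 0 T, ∀ α : ℝ → Y, α 0 = ⟨c₀, hc₀⟩ →
        (∀ t ∈ Icc 0 s, HasDerivWithinAt α (V t (α t)) (Icc 0 s) t) →
        ∀ t ∈ Icc 0 s, ‖α t‖ ≤ R := by
    intro T hT
    set R : ℝ := Real.sqrt (∑ k, ‖c₀ k‖ ^ 2) with hR
    refine ⟨R, ?_, ?_⟩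
    · change ‖c₀‖ ≤ R
      exact norm_le_sqrt_sum_norm_sq c₀
    · intro s hs α hα0 hα t ht
      set γ : ℝ → ↥S → EuclideanSpace ℂ d := fun τ => (α τ : ↥S → EuclideanSpace ℂ d) with hγ
      have hγ' : ∀ τ ∈ Icc 0 s, HasDerivWithinAt γ (pvsRHS S 𝔸 (b τ) (γ τ)) (Icc 0 s) τ := by
        intro τ hτ
        exact Y.subtypeL.hasFDerivAt.comp_hasDerivWithinAt τ (hα τ hτ)
      have hmem : ∀ τ ∈ Icc 0 s, γ τ ∈ galerkinSubspace S := fun τ _ => (α τ).2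
      have hdec := pvsEnergy_antitone_of_solution h𝔸 hlo hS hb.smooth hb.divFree hγ' hmem le_rfl ht.1 ht.2
      have hγ0 : γ 0 = c₀ := by simp [hγ, hα0]
      rw [hγ0] at hdec
      change ‖γ t‖ ≤ R
      exact (norm_le_sqrt_sum_norm_sq (γ t)).trans (Real.sqrt_le_sqrt hdec)
  obtain ⟨α, hα0, hα⟩ := ODE.exists_solution_of_apriori_bound hlip hcont hapriori
  have hsol : ∀ T, ∀ t ∈ Icc 0 T, HasDerivWithinAt (fun t => (α t : ↥S → EuclideanSpace ℂ d))
      (pvsRHS S 𝔸 (b t) (α t)) (Icc 0 T) t := fun T t ht =>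
    Y.subtypeL.hasFDerivAt.comp_hasDerivWithinAt t (hα T t ht)
  refine ⟨fun t => (α t : ↥S → EuclideanSpace ℂ d), by simp [hα0], fun t => (α t).2, ?_, hsol, ?_⟩
  · intro t ht
    have hc := IsIntegralCurveOn.continuousOn (hα (t + 1)) t ⟨ht, by linarith⟩
    have hmem : Icc 0 (t + 1) ∈ 𝓝[Ici 0] t :=
      Filter.mem_of_superset (inter_mem_nhdsWithin (Ici (0 : ℝ)) (Iio_mem_nhds (by linarith)))
        fun s hs => ⟨hs.1, hs.2.le⟩
    exact (continuous_subtype_val.continuousAt.comp_continuousWithinAt hc).mono_of_mem_nhdsWithin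
      hmem
  · intro t₁ t h1 h1t
    exact pvsEnergy_antitone_of_solution h𝔸 hlo hS hb.smooth hb.divFree (hsol t) (fun τ _ => (α τ).2) h1 h1t
      le_rfl

end Energy

/-! ## §4 The `N`-uniform per-mode bound of the transport coefficient (antisymmetry) -/

section PerMode

variable [DecidableEq d] {S : Finset (d → ℤ)}

omit [DecidableEq d] in
/-- `‖toLp f‖² = ∫‖f‖²` for `f ∈ L²`. [folklore] -/
private theorem norm_toLp_sq₀ {f : UnitAddTorus d → EuclideanSpace ℝ d} (hf : MemLp f 2 volume) :
    ‖hf.toLp f‖ ^ 2 = ∫ x, ‖f x‖ ^ 2 := by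
  rw [← real_inner_self_eq_norm_sq, MeasureTheory.L2.inner_def]
  refine integral_congr_ae ?_
  filter_upwards [hf.coeFn_toLp] with x hx
  rw [hx, real_inner_self_eq_norm_sq]

omit [DecidableEq d] in
/-- Cauchy–Schwarz for the `L²` pairing: `|∫⟪f, g⟫| ≤ √(∫‖f‖²)·√(∫‖g‖²)`. [folklore] -/
private theorem abs_integral_inner_le_sqrt_mul_sqrt₀ {f g : UnitAddTorus d → EuclideanSpace ℝ d} (hf : MemLp f 2 volume)
    (hg : MemLp g 2 volume) :
    |∫ x, ⟪f x, g x⟫_ℝ| ≤ Real.sqrt (∫ x, ‖f x‖ ^ 2) * Real.sqrt (∫ x, ‖g x‖ ^ 2) := by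
  have e : ∫ x, ⟪f x, g x⟫_ℝ = ⟪hf.toLp f, hg.toLp g⟫_ℝ := by
    rw [MeasureTheory.L2.inner_def]
    refine integral_congr_ae ?_
    filter_upwards [hf.coeFn_toLp, hg.coeFn_toLp] with x hx hy
    rw [hx, hy]
  have hf' : ‖hf.toLp f‖ = Real.sqrt (∫ x, ‖f x‖ ^ 2) := by
    rw [← norm_toLp_sq₀ hf, Real.sqrt_sq (norm_nonneg _)]
  have hg' : ‖hg.toLp g‖ = Real.sqrt (∫ x, ‖g x‖ ^ 2) := by
    rw [← norm_toLp_sq₀ hg, Real.sqrt_sq (norm_nonneg _)]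
  rw [e, ← hf', ← hg']
  exact abs_real_inner_le_norm _ _

/-- **Real pairing of the transport coefficient with a vector**:
`Re⟪𝓕[(b·∇)u](k), z⟫ = −∫⟪u, (b·∇) Re(e_k • z)⟫` for a smooth divergence-free `b` (Parseval against the single real
mode and antisymmetry of the trilinear form). [cite: RobinsonRodrigoSadowski2016, Lemma 3.2] -/
theorem re_inner_pvsConvCoeff_eq {b : UnitAddTorus d → EuclideanSpace ℝ d} (hb : IsSmooth b) (hbdiv : IsDivFree b)
    (c : (d → ℤ) → EuclideanSpace ℂ d) (k : d → ℤ) (z : EuclideanSpace ℂ d) :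
    (inner ℂ (pvsConvCoeff S b c k) z).re =
      -∫ x, ⟪realTrigPoly S c x, FunctionSpaces.Torus.convect b (realTrigPoly {k} (fun _ => z)) x⟫_ℝ := by
  have hu : IsSmooth (realTrigPoly S c) := isSmooth_realTrigPoly S c
  have hG : IsSmooth (realTrigPoly {k} (fun _ : d → ℤ => z)) := isSmooth_realTrigPoly _ _
  have hint : Integrable (FunctionSpaces.Torus.convect b (realTrigPoly S c)) volume :=
    (memLp_convect_realTrigPoly hb.continuous c 2).integrable one_le_two
  have h1 := integral_inner_realTrigPoly_singleton hint k (fun _ => z)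
  rw [pvsConvCoeff_def, ← h1, integral_inner_convect_eq_neg hb hbdiv hu hG]

/-- `‖(b·∇) Re(e_k • z) (x)‖ ≤ M · 2π (∑_j |k_j|) ‖z‖` for `‖b x‖ ≤ M`. [cite: RobinsonRodrigoSadowski2016, Thm. 4.4 Step 1 (4.5)] -/
theorem norm_convect_realTrigPoly_singleton_le {b : UnitAddTorus d → EuclideanSpace ℝ d} {M : ℝ} (hM : 0 ≤ M)
    (hbM : ∀ x, ‖b x‖ ≤ M) (k : d → ℤ) (z : EuclideanSpace ℂ d) (x : UnitAddTorus d) :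
    ‖FunctionSpaces.Torus.convect b (realTrigPoly {k} (fun _ => z)) x‖ ≤ M * (2 * Real.pi * (∑ j, |(k j : ℝ)|) * ‖z‖) := by
  have h := norm_convect_realTrigPoly_le (S := {k}) hM hbM (R := ‖z‖) (fun l _ => le_rfl) x
  simpa using h

/-- `∫‖(b·∇) Re(e_k • z)‖² ≤ (M · 2π (∑_j |k_j|) ‖z‖)²` for `‖b‖ ≤ M`. [cite: RobinsonRodrigoSadowski2016, Thm. 4.4 Step 1 (4.5)] -/
theorem integral_norm_sq_convect_single_le {b : UnitAddTorus d → EuclideanSpace ℝ d} (hb : IsSmooth b) {M : ℝ} (hM : 0 ≤ M)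
    (hbM : ∀ x, ‖b x‖ ≤ M) (k : d → ℤ) (z : EuclideanSpace ℂ d) :
    ∫ x, ‖FunctionSpaces.Torus.convect b (realTrigPoly {k} (fun _ => z)) x‖ ^ 2 ≤
      (M * (2 * Real.pi * (∑ j, |(k j : ℝ)|) * ‖z‖)) ^ 2 := by
  have hG : Continuous (FunctionSpaces.Torus.convect b (realTrigPoly {k} (fun _ : d → ℤ => z))) :=
    (hb.convect (isSmooth_realTrigPoly _ _)).continuous
  have hGm : MemLp (FunctionSpaces.Torus.convect b (realTrigPoly {k} (fun _ : d → ℤ => z))) 2 volume :=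
    hG.memLp_of_hasCompactSupport (HasCompactSupport.of_compactSpace _)
  refine integral_le_of_le_const (hGm.integrable_norm_pow two_ne_zero) fun x => ?_
  have h1 := norm_convect_realTrigPoly_singleton_le hM hbM k z x
  have h0 : 0 ≤ ‖FunctionSpaces.Torus.convect b (realTrigPoly {k} (fun _ : d → ℤ => z)) x‖ := norm_nonneg _
  exact pow_le_pow_left₀ h0 h1 2

/-- **The real pairings of the transport coefficient are controlled by the energy**:
`Re⟪𝓕[(b·∇)u](k), z⟫ ≤ (∫‖u‖²)^{1/2} · M · 2π(∑_j|k_j|)‖z‖`. [cite: RobinsonRodrigoSadowski2016, Ex. 4.2] -/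
theorem re_inner_pvsConvCoeff_le {b : UnitAddTorus d → EuclideanSpace ℝ d} (hb : IsSmooth b) (hbdiv : IsDivFree b)
    {M : ℝ} (hM : 0 ≤ M) (hbM : ∀ x, ‖b x‖ ≤ M) (c : (d → ℤ) → EuclideanSpace ℂ d) (k : d → ℤ) (z : EuclideanSpace ℂ d) :
    (inner ℂ (pvsConvCoeff S b c k) z).re ≤
      Real.sqrt (∫ x, ‖realTrigPoly S c x‖ ^ 2) * (M * (2 * Real.pi * (∑ j, |(k j : ℝ)|) * ‖z‖)) := by
  rw [re_inner_pvsConvCoeff_eq hb hbdiv c k z]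
  have hG : Continuous (FunctionSpaces.Torus.convect b (realTrigPoly {k} (fun _ : d → ℤ => z))) :=
    (hb.convect (isSmooth_realTrigPoly _ _)).continuous
  have hGm : MemLp (FunctionSpaces.Torus.convect b (realTrigPoly {k} (fun _ : d → ℤ => z))) 2 volume :=
    hG.memLp_of_hasCompactSupport (HasCompactSupport.of_compactSpace _)
  have hCS := abs_integral_inner_le_sqrt_mul_sqrt₀ (memLp_realTrigPoly S c 2) hGm
  have hL0 : 0 ≤ M * (2 * Real.pi * (∑ j, |(k j : ℝ)|) * ‖z‖) := by positivity
  have hGL : Real.sqrt (∫ x, ‖FunctionSpaces.Torus.convect b (realTrigPoly {k} (fun _ : d → ℤ => z)) x‖ ^ 2) ≤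
      M * (2 * Real.pi * (∑ j, |(k j : ℝ)|) * ‖z‖) := by
    calc _ ≤ Real.sqrt ((M * (2 * Real.pi * (∑ j, |(k j : ℝ)|) * ‖z‖)) ^ 2) :=
          Real.sqrt_le_sqrt (integral_norm_sq_convect_single_le hb hM hbM k z)
      _ = _ := Real.sqrt_sq hL0
  calc -∫ x, ⟪realTrigPoly S c x, FunctionSpaces.Torus.convect b (realTrigPoly {k} (fun _ : d → ℤ => z)) x⟫_ℝ
      ≤ |∫ x, ⟪realTrigPoly S c x, FunctionSpaces.Torus.convect b (realTrigPoly {k} (fun _ : d → ℤ => z)) x⟫_ℝ| :=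
        neg_le_abs _
    _ ≤ Real.sqrt (∫ x, ‖realTrigPoly S c x‖ ^ 2) *
        Real.sqrt (∫ x, ‖FunctionSpaces.Torus.convect b (realTrigPoly {k} (fun _ : d → ℤ => z)) x‖ ^ 2) := hCS
    _ ≤ _ := mul_le_mul_of_nonneg_left hGL (Real.sqrt_nonneg _)

/-- **`N`-uniform bound of the transport coefficient**: `‖𝓕[(b·∇)u](k)‖ ≤ M · 2π (∑_j |k_j|) · (∫‖u‖²)^{1/2}`,
`u = realTrigPoly S c`, INDEPENDENT of `S` — mode `k` of the transport is fed at a rate controlled by `‖u‖_{L²}` alone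
(antisymmetry of the trilinear form). [cite: RobinsonRodrigoSadowski2016, Ex. 4.2] -/
theorem norm_pvsConvCoeff_le_of_energy {b : UnitAddTorus d → EuclideanSpace ℝ d} (hb : IsSmooth b) (hbdiv : IsDivFree b)
    {M : ℝ} (hM : 0 ≤ M) (hbM : ∀ x, ‖b x‖ ≤ M) (c : (d → ℤ) → EuclideanSpace ℂ d) (k : d → ℤ) :
    ‖pvsConvCoeff S b c k‖ ≤ M * (2 * Real.pi * ∑ j, |(k j : ℝ)|) * Real.sqrt (∫ x, ‖realTrigPoly S c x‖ ^ 2) := by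
  have hA0 : 0 ≤ M * (2 * Real.pi * ∑ j, |(k j : ℝ)|) * Real.sqrt (∫ x, ‖realTrigPoly S c x‖ ^ 2) := by positivity
  have key := re_inner_pvsConvCoeff_le (S := S) hb hbdiv hM hbM c k (pvsConvCoeff S b c k)
  have e1 : ‖pvsConvCoeff S b c k‖ ^ 2 = (inner ℂ (pvsConvCoeff S b c k) (pvsConvCoeff S b c k)).re := by
    have h := inner_self_eq_norm_sq (𝕜 := ℂ) (pvsConvCoeff S b c k)
    rw [← h]
    rfl
  have h2 : ‖pvsConvCoeff S b c k‖ * ‖pvsConvCoeff S b c k‖ ≤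
      (M * (2 * Real.pi * ∑ j, |(k j : ℝ)|) * Real.sqrt (∫ x, ‖realTrigPoly S c x‖ ^ 2)) * ‖pvsConvCoeff S b c k‖ := by
    calc ‖pvsConvCoeff S b c k‖ * ‖pvsConvCoeff S b c k‖ = ‖pvsConvCoeff S b c k‖ ^ 2 := by ring
      _ ≤ Real.sqrt (∫ x, ‖realTrigPoly S c x‖ ^ 2) * (M * (2 * Real.pi * (∑ j, |(k j : ℝ)|) * ‖pvsConvCoeff S b c k‖)) := by
          rw [e1]; exact key
      _ = _ := by ring
  by_cases hw0 : ‖pvsConvCoeff S b c k‖ = 0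
  · rw [hw0]; exact hA0
  · exact le_of_mul_le_mul_right h2 (lt_of_le_of_ne (norm_nonneg _) (Ne.symm hw0))

end PerMode

end PVS

end Literature.Analysis.FluidPDE
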